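import Summits.QuantumFields.BalabanUV.Beta.GAN24.CombEVHSwapWordZeroStep
import Summits.QuantumFields.BalabanUV.Beta.GAN24.CombEEWordTransferStep
import Summits.QuantumFields.BalabanUV.Beta.GAN24.CombExitFaceCurrentDivFree
import Summits.QuantumFields.BalabanUV.Beta.GAN24.CombForcingWordsLevelZero

/-!
# `BalabanUV.Beta.GAN24.CombForcingWordsSucc` — binder row G-an2-4 ∕ (CONV-C), TRANSFER-III, the (III′) (C)-campaign's supplier `hB0` AT LEVELS `j + 1 ≥ 1`: **30 AT THE COMB DATA,
# LEVEL `j+1` — THE TWO EXCHANGE WORDS OF THE ff ZERO MODE OF THE COMB CHART'S E-FRAME FORCING AT LEVEL `j+1` ARE THE TWO `E ⊗ E` WORDS OVER THE UNTRANSPORTED COMB CUBIC SECTOR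
# `W_j := (cE·wE_{j+1}) • e3OfK Lc G_j (𝒯 S̃comb_j)`, GIVEN (Z)_comb ALONE** — leaf-04 g69's 30_{j+1} (`DressedSourceZeroModeSucc` Part A) AT THE COMB DATA, i.e. leaf-01 g86's level-`0`
# F `CombForcingWordsLevelZero` with `0 ↦ j+1`: the sector split F6 `dM_comb_succ_split` in both slots of both words of F2's 21, the eighteen sector words evaluated BY NAME — `E′⊗E′` →
# this gen's `CombEEWordTransferStep` (the transport drops; NO value claimed), `E′⊗VH′` → this gen's `CombEVHWordsZeroStep ∕ CombEVHSwapWordZeroStep` (⟸ (D)_comb ∧ (Z)_comb),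
# `VH′⊗E′` → leaf-01's C `CombVHEWordsZeroStep` (⟸ (D)_comb ∧ (Z)_comb), `VH′⊗VH′` → leaf-04's 28 on F3's sockets, the ten multiplier words → leaf-04's 23 on the transported multiplier
# family (F2 ∕ F5 sockets); (D)_comb := leaf-01 g87's K `CombExitFaceCurrentDivFree.comb_exitFace_pairCurrent_divFree` BY NAME, (Z)_comb DISPLAYED (`hZ`, all slot and face directions)
# (G-an2-4 ∕ (CONV-C) OWNER `b2b-balaban-gan24-p1`, gen 53; journal [GAN24P1-G53-INTENT-2])

NOT IN PRINT; OUR BOOKKEEPING ([folklore] finite bookkeeping BY NAME over leaf-01 g85∕g86∕g87 F2 ∕ F3 ∕ F5 ∕ F6 ∕ C ∕ K, this gen's X1 ∕ X2 ∕ Y0, leaf-04 g66's 23 `MultiplierWordsZero`, 28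
`VHWordsZeroBorder`, 30 `DressedSourceExchangeWords` (`tsum_direct_word_split ∕ tsum_swap_word_split`), 22 `ExchangeSlotResum` (covariance swap); 0 `def`, 0 cited fact, 0 `def … : Prop`,
0 sorry).  HONEST FRAMING (cell contract, verbatim): «discharging `BetaPertH` makes Bałaban's UV stability UNCONDITIONAL — a real constructive-QFT result; it is NOT the continuum limit and
NOT the Clay problem.»  HONEST DEPENDENCY (verbatim): «continuum YM on T⁴ ⇐ BetaPertH ∧ nine spine estimates (0/9 proved); BetaPertH ⇐ (D1) ∧ (D4) ∧ CAP+tail; G-an2-4 gates asym, D1 and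
NE2/3/4.»

WHAT ([folklore]; generic `d`, `[NeZero Lc]`, every `j`, period `Lc`, all units `s_f s_m`, an1's record `symTablesAn1S2 d Lc cΛt`, colour constants `cE cVH cΛ`, ANY axes `(μ, ν, α, β)`; the
kernel root SPELLED `toSite (ctrOff (d+1) Lc)` (`= ctr (d+1) Lc` by `rfl`) in the kernel `X̃_{j+1}` AND in `G_j`).  With `𝒯S̃′_{j+1} = Ψ̂ᵀ∘slotPsiS (ctrOff) Lc (unitS s_f s_m (SpureCombOf tabs cE cVH cΛ (j+1)))∘Ψ̂`,
`𝒯′M̃′_{j+1} ρ w = Ψ̂ᵀ∘unitM s_f s_m (tabs.M (j+1)) ρ w∘Ψ̂`, `FF[K] = Σ'_{(y,w)} 𝟙f(y_α)𝟙f(w_β)·K y w (inl α)(inl β)`, `V^W_{κ,u} = vertexOfK X̃_{j+1} Lc (unitS s_f s_m W_j) κ u`, and the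
HYPOTHESIS (Z)_comb `hZ : ∀ κ₀ γ b, Σ_{r′∈box} Σ'_{(u,w)} 𝟙f(w_γ)·V^W_{κ₀,u} (toSite r′) w (inl b)(inl γ) = 0`:
**`sum_box_comb_direct_word_succ_eq`**: `Σ_{c∈box Lc} Σ'_{u′} FF[(dM X̃_{j+1} Lc 𝒯S̃′_{j+1} 𝒯′M̃′_{j+1} μ c ∘ X̃_{j+1}) ∘ dM … ν u′] = Σ_{c∈box Lc} Σ'_{u′} FF[(V^W_{μ,c} ∘ X̃_{j+1}) ∘ V^W_{ν,u′}]`;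
**`sum_box_comb_swap_word_succ_eq`**: `Σ_{c∈box Lc} Σ'_{u′} FF[(dM … ν u′ ∘ X̃_{j+1}) ∘ dM … μ c] = Σ_{c∈box Lc} Σ'_{u′} FF[(V^W_{ν,u′} ∘ X̃_{j+1}) ∘ V^W_{μ,c}]` — leaf-04's 33_j right-hand words
`EE_direct ∕ EE_swap` with `SrecAt j ↦ 𝒯 S̃comb_j` and an1's record; their antisymmetric PAIR FORM (J2's twin at the comb data) and the 33∕`hB0 (j+1)` junction are the NEXT files.
Asserts NO value of Bałaban's tables; NOT `hB0`; (Z)_comb NOT proved; NEVER «G-an2-4 closed» as (CONV-C); NOT D1, NOT `BetaPertH`, NOT continuum, NOT Clay.  2026-08-27; no existing file touched.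
-/

noncomputable section

open Finset
open scoped BigOperators
open Literature.MathematicalPhysics.QuantumFieldTheory
open Literature.MathematicalPhysics.QuantumFieldTheory.Balaban1983to89
open Literature.MathematicalPhysics.QuantumFieldTheory.Balaban1983to89.Beta
open ExpKernelCalculus (Site MKer comp shiftK Decays BiLoc VertexFamily)
open OneStepResolventKernel (Fib LocStencil decays_mono biLoc_mono)
open OneStepKernelFamily (KInvStep vertexOfK vertexFamily_vertexOfK)
open SecondOrderResponse (dM vertexOfM vertexFamily_vertexOfM)
open BalabanStepJetsSucc (wE wVH)
open AffineAveraging (box toSite unitVec)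
open AveragingContoursRooted (ctr ctrOff ctrOff_mem_box)
open Summit.QuantumFields.BalabanUV.Beta.SymAveragingHessianCounts (symVhSAt)
open Summit.QuantumFields.BalabanUV.Beta.TameKernelCalculus (trK Loc Spr)
open Summit.QuantumFields.BalabanUV.Beta.AxialDressingRooted (coDressKBmAt)
open Summit.QuantumFields.BalabanUV.Beta.HessKerDressedUnits (unitK unitS)
open Summit.QuantumFields.BalabanUV.Beta.SecondOrderUnits (unitM)
open Summit.QuantumFields.BalabanUV.Beta.SpineRooted (e3OfK)
open Summit.QuantumFields.BalabanUV.Beta.SymmetrisedStepJets (SymTables)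
open Summit.QuantumFields.BalabanUV.Beta.SymSecondOrderTablesAn1 (symTablesAn1S2 symTablesAn1S2_V)
open Summit.QuantumFields.BalabanUV.Beta.CombChartStepJets (ScombOf SpureCombOf)
open Summit.QuantumFields.BalabanUV.Beta.SymCorrectorKernel (psiKS)
open Summit.QuantumFields.BalabanUV.Beta.SymCorrectorFace (slotPsiS)
open Summit.QuantumFields.BalabanUV.Beta.GAN24.CombTransportedBorder (pos_Lc locStencil_symVhS symVhS_inl_inl symVhS_translate symVhS_inr_fst_eq_zero symVhS_inr_snd_eq_zero
  transport_inl_inl transport_translate transport_inr_fst_eq_zero transport_inr_snd_eq_zero exists_locStencil_transport_symVhS)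
open Summit.QuantumFields.BalabanUV.Beta.GAN24.CombForcingTwoFaceWords (exists_vertexFamily_transport_M)
open Summit.QuantumFields.BalabanUV.Beta.GAN24.CombWWordZero (transportM_translate)
open Summit.QuantumFields.BalabanUV.Beta.GAN24.CombForcingSectorSplit (dM_comb_succ_split exists_sector_data_comb_succ VH_translate transport_translate_comb)
open Summit.QuantumFields.BalabanUV.Beta.GAN24.ExchangeSlotResum (face_weight_periodic tsum_eq_tsum_of_cov twoFace_word_cov_of)
open Summit.QuantumFields.BalabanUV.Beta.GAN24.EEWordReduced (shiftK_dressedStep)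
open Summit.QuantumFields.BalabanUV.Beta.GAN24.VHWordsZeroBorder (borderSlot_translate sum_box_border_border_words_eq_zero)
open Summit.QuantumFields.BalabanUV.Beta.GAN24.MultiplierWordsZero (tsum_right_vertexOfM_word_eq_zero tsum_left_vertexOfM_word_eq_zero tsum_vertexOfM_left_cov_word_eq_zero
  tsum_vertexOfM_right_cov_word_eq_zero)
open Summit.QuantumFields.BalabanUV.Beta.GAN24.DressedSourceExchangeWords (tsum_direct_word_split tsum_swap_word_split)
open Summit.QuantumFields.BalabanUV.Beta.GAN24.CombVHEWordsZeroStep (sector_translate vertexSector_translate exists_locStencil_transport_ScombOf transport_ScombOf_translate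
  parityOdd_transport_ScombOf tsum_transported_noFF_sector_word_eq_zero_of_divFree tsum_transported_sector_noFF_word_eq_zero_of_divFree)
open Summit.QuantumFields.BalabanUV.Beta.GAN24.CombExitFaceCurrentDivFree (comb_exitFace_pairCurrent_divFree)
open Summit.QuantumFields.BalabanUV.Beta.GAN24.CombEVHWordsZeroStep (sum_box_transported_sector_border_word_eq_zero_of_divFree)
open Summit.QuantumFields.BalabanUV.Beta.GAN24.CombEVHSwapWordZeroStep (sum_box_transported_border_sector_swap_word_eq_zero_of_divFree)
open Summit.QuantumFields.BalabanUV.Beta.GAN24.CombEEWordTransferStep (sum_box_transported_sector_ee_word_eq)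

namespace Summit.QuantumFields.BalabanUV.Beta.GAN24.CombForcingWordsSucc

variable {d : ℕ} {Lc : ℕ} [NeZero Lc]

section Words

variable {μ ν α β : Fin (d + 1)}

/-- NOT IN PRINT; OUR BOOKKEEPING ([folklore]; 30's DIRECT WORD AT THE COMB DATA, LEVEL `j+1`, GIVEN (Z)_comb).  **THE DIRECT EXCHANGE WORD OF THE COMB FORCING'S ff ZERO MODE AT LEVEL `j+1`
IS THE DIRECT `E ⊗ E` WORD OVER THE UNTRANSPORTED COMB CUBIC SECTOR** (an1's record, all units, colour constants `cE cVH cΛ`, ANY axes):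
`Σ_{c∈box Lc} Σ'_{u′} FF[(dM X̃_{j+1} Lc 𝒯S̃′_{j+1} 𝒯′M̃′_{j+1} μ c ∘ X̃_{j+1}) ∘ dM X̃_{j+1} Lc 𝒯S̃′_{j+1} 𝒯′M̃′_{j+1} ν u′] = Σ_{c∈box Lc} Σ'_{u′} FF[(V^W_{μ,c} ∘ X̃_{j+1}) ∘ V^W_{ν,u′}]` — F6's split in both
slots, 30's `tsum_direct_word_split`, then Y0 (`E′⊗E′`: the transport drops), X1 (`E′⊗VH′` ⟸ (D)(Z) at `(μ, α)`), C (`VH′⊗E′` ⟸ (D)(Z) at `(ν, β)`), 28 (`VH′⊗VH′`) on F3's sockets, 23's five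
multiplier zeros on the transported multiplier family; (D) := K §3. -/
theorem sum_box_comb_direct_word_succ_eq (sf sm cΛt cE cVH cΛ : ℝ) (j : ℕ)
    (hZ : ∀ (κ₀ γ b : Fin (d + 1)), ∑ r' ∈ box (d + 1) Lc, ∑' uw : Site (d + 1) × Site (d + 1), (if uw.2 γ % (Lc : ℤ) = (Lc : ℤ) - 1 then (1 : ℝ) else 0) *
        vertexOfK (unitK sf sm (coDressKBmAt (toSite (ctrOff (d + 1) Lc)) Lc (KInvStep (d := d) Lc (j + 1)))) Lc (unitS sf sm (fun κ t => (cE * wE d Lc (j + 1)) • e3OfK Lc (coDressKBmAt (toSite (ctrOff (d + 1) Lc)) Lc (KInvStep (d := d) Lc j))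
              (fun κ u => comp (comp (trK (psiKS (ctrOff (d + 1) Lc) Lc)) (slotPsiS (ctrOff (d + 1) Lc) Lc (ScombOf (symTablesAn1S2 d Lc cΛt) cE cVH cΛ j) κ u)) (psiKS (ctrOff (d + 1) Lc) Lc)) κ t)) κ₀ uw.1 (toSite r') uw.2 (Sum.inl b) (Sum.inl γ) = 0) :
    ∑ c ∈ box (d + 1) Lc, ∑' u' : Site (d + 1), ∑' yw : Site (d + 1) × Site (d + 1), (if yw.1 α % (Lc : ℤ) = (Lc : ℤ) - 1 then (1 : ℝ) else 0) * (if yw.2 β % (Lc : ℤ) = (Lc : ℤ) - 1 then (1 : ℝ) else 0) *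
        comp (comp (dM (unitK sf sm (coDressKBmAt (toSite (ctrOff (d + 1) Lc)) Lc (KInvStep (d := d) Lc (j + 1)))) Lc
            (fun κ u => comp (comp (trK (psiKS (ctrOff (d + 1) Lc) Lc)) (slotPsiS (ctrOff (d + 1) Lc) Lc (unitS sf sm (SpureCombOf (symTablesAn1S2 d Lc cΛt) cE cVH cΛ (j + 1))) κ u)) (psiKS (ctrOff (d + 1) Lc) Lc))
            (fun ρ w => comp (comp (trK (psiKS (ctrOff (d + 1) Lc) Lc)) (unitM sf sm ((symTablesAn1S2 d Lc cΛt).M (j + 1)) ρ w)) (psiKS (ctrOff (d + 1) Lc) Lc)) μ (toSite c)) (unitK sf sm (coDressKBmAt (toSite (ctrOff (d + 1) Lc)) Lc (KInvStep (d := d) Lc (j + 1)))))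
          (dM (unitK sf sm (coDressKBmAt (toSite (ctrOff (d + 1) Lc)) Lc (KInvStep (d := d) Lc (j + 1)))) Lc
            (fun κ u => comp (comp (trK (psiKS (ctrOff (d + 1) Lc) Lc)) (slotPsiS (ctrOff (d + 1) Lc) Lc (unitS sf sm (SpureCombOf (symTablesAn1S2 d Lc cΛt) cE cVH cΛ (j + 1))) κ u)) (psiKS (ctrOff (d + 1) Lc) Lc))
            (fun ρ w => comp (comp (trK (psiKS (ctrOff (d + 1) Lc) Lc)) (unitM sf sm ((symTablesAn1S2 d Lc cΛt).M (j + 1)) ρ w)) (psiKS (ctrOff (d + 1) Lc) Lc)) ν u') yw.1 yw.2 (Sum.inl α) (Sum.inl β) =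
      ∑ c ∈ box (d + 1) Lc, ∑' u' : Site (d + 1), ∑' yw : Site (d + 1) × Site (d + 1), (if yw.1 α % (Lc : ℤ) = (Lc : ℤ) - 1 then (1 : ℝ) else 0) * (if yw.2 β % (Lc : ℤ) = (Lc : ℤ) - 1 then (1 : ℝ) else 0) *
        comp (comp (vertexOfK (unitK sf sm (coDressKBmAt (toSite (ctrOff (d + 1) Lc)) Lc (KInvStep (d := d) Lc (j + 1)))) Lc (unitS sf sm (fun κ t => (cE * wE d Lc (j + 1)) • e3OfK Lc (coDressKBmAt (toSite (ctrOff (d + 1) Lc)) Lc (KInvStep (d := d) Lc j))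
              (fun κ u => comp (comp (trK (psiKS (ctrOff (d + 1) Lc) Lc)) (slotPsiS (ctrOff (d + 1) Lc) Lc (ScombOf (symTablesAn1S2 d Lc cΛt) cE cVH cΛ j) κ u)) (psiKS (ctrOff (d + 1) Lc) Lc)) κ t)) μ (toSite c)) (unitK sf sm (coDressKBmAt (toSite (ctrOff (d + 1) Lc)) Lc (KInvStep (d := d) Lc (j + 1)))))
          (vertexOfK (unitK sf sm (coDressKBmAt (toSite (ctrOff (d + 1) Lc)) Lc (KInvStep (d := d) Lc (j + 1)))) Lc (unitS sf sm (fun κ t => (cE * wE d Lc (j + 1)) • e3OfK Lc (coDressKBmAt (toSite (ctrOff (d + 1) Lc)) Lc (KInvStep (d := d) Lc j))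
              (fun κ u => comp (comp (trK (psiKS (ctrOff (d + 1) Lc) Lc)) (slotPsiS (ctrOff (d + 1) Lc) Lc (ScombOf (symTablesAn1S2 d Lc cΛt) cE cVH cΛ j) κ u)) (psiKS (ctrOff (d + 1) Lc) Lc)) κ t)) ν u') yw.1 yw.2 (Sum.inl α) (Sum.inl β) := by
  classical
  have hLc : 1 ≤ Lc := Nat.one_le_iff_ne_zero.mpr (NeZero.ne Lc)
  have hr0 := ctrOff_mem_box (d := d + 1) (pos_Lc (Lc := Lc))
  -- the transported folded comb member `𝒯 S̃comb_j` (C §3) and the transported multiplier family (F2 ∕ F5)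
  obtain ⟨CMc, δMc, hδMc, hMc⟩ := exists_locStencil_transport_ScombOf (d := d) (Lc := Lc) cΛt cE cVH cΛ j
  have hMct := fun (κ : Fin (d + 1)) (u t : Site (d + 1)) => transport_ScombOf_translate (d := d) (Lc := Lc) cΛt cE cVH cΛ j κ u t
  have hMcp := fun (κ : Fin (d + 1)) (u : Site (d + 1)) => parityOdd_transport_ScombOf (d := d) (Lc := Lc) cΛt cE cVH cΛ j κ u
  obtain ⟨CM, δM, hδM, hM⟩ := exists_vertexFamily_transport_M (symTablesAn1S2 d Lc cΛt) sf sm (j + 1)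
  have hMcov := transportM_translate (symTablesAn1S2 d Lc cΛt) sf sm (j + 1)
  -- one rate for the three level-(j+1) comb sectors (F6, the kernel root respelled `toSite (ctrOff (d+1) Lc)`)
  obtain ⟨δ, CX, Cv, Cw, Cm, hδ, hXd, hVE, hVW, hVM⟩ : ∃ δ CX Cv Cw Cm : ℝ, 0 < δ ∧ Decays (unitK sf sm (coDressKBmAt (toSite (ctrOff (d + 1) Lc)) Lc (KInvStep (d := d) Lc (j + 1)))) CX δ ∧
      VertexFamily (vertexOfK (unitK sf sm (coDressKBmAt (toSite (ctrOff (d + 1) Lc)) Lc (KInvStep (d := d) Lc (j + 1)))) Lc (unitS sf sm (fun κ u => comp (comp (trK (psiKS (ctrOff (d + 1) Lc) Lc)) (slotPsiS (ctrOff (d + 1) Lc) Lc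
            (fun κ t => (cE * wE d Lc (j + 1)) • e3OfK Lc (coDressKBmAt (toSite (ctrOff (d + 1) Lc)) Lc (KInvStep (d := d) Lc j))
              (fun κ u => comp (comp (trK (psiKS (ctrOff (d + 1) Lc) Lc)) (slotPsiS (ctrOff (d + 1) Lc) Lc (ScombOf (symTablesAn1S2 d Lc cΛt) cE cVH cΛ j) κ u)) (psiKS (ctrOff (d + 1) Lc) Lc)) κ t) κ u)) (psiKS (ctrOff (d + 1) Lc) Lc)))) Lc Cv δ ∧
      VertexFamily (vertexOfK (unitK sf sm (coDressKBmAt (toSite (ctrOff (d + 1) Lc)) Lc (KInvStep (d := d) Lc (j + 1)))) Lc (unitS sf sm (fun κ u => comp (comp (trK (psiKS (ctrOff (d + 1) Lc) Lc)) (slotPsiS (ctrOff (d + 1) Lc) Lc (fun κ u => (cVH * wVH d Lc (j + 1)) • (symTablesAn1S2 d Lc cΛt).V κ u) κ u)) (psiKS (ctrOff (d + 1) Lc) Lc)))) Lc Cw δ ∧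
      VertexFamily (vertexOfM (unitK sf sm (coDressKBmAt (toSite (ctrOff (d + 1) Lc)) Lc (KInvStep (d := d) Lc (j + 1)))) Lc (fun ρ w => comp (comp (trK (psiKS (ctrOff (d + 1) Lc) Lc)) (unitM sf sm ((symTablesAn1S2 d Lc cΛt).M (j + 1)) ρ w)) (psiKS (ctrOff (d + 1) Lc) Lc))) Lc Cm δ :=
    exists_sector_data_comb_succ (symTablesAn1S2 d Lc cΛt) sf sm cE cVH cΛ j hM hδM
  have hX : Spr (unitK sf sm (coDressKBmAt (toSite (ctrOff (d + 1) Lc)) Lc (KInvStep (d := d) Lc (j + 1)))) := ⟨_, _, hδ, hXd⟩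
  have hXs : ∀ t : Site (d + 1), shiftK (-((Lc : ℤ) • t)) (unitK sf sm (coDressKBmAt (toSite (ctrOff (d + 1) Lc)) Lc (KInvStep (d := d) Lc (j + 1)))) = unitK sf sm (coDressKBmAt (toSite (ctrOff (d + 1) Lc)) Lc (KInvStep (d := d) Lc (j + 1))) := fun t => shiftK_dressedStep (r := ctrOff (d + 1) Lc) hLc sf sm (j + 1) t
  have hLE : ∀ (κ : Fin (d + 1)) (u : Site (d + 1)), Loc (vertexOfK (unitK sf sm (coDressKBmAt (toSite (ctrOff (d + 1) Lc)) Lc (KInvStep (d := d) Lc (j + 1)))) Lc (unitS sf sm (fun κ u => comp (comp (trK (psiKS (ctrOff (d + 1) Lc) Lc)) (slotPsiS (ctrOff (d + 1) Lc) Lc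
            (fun κ t => (cE * wE d Lc (j + 1)) • e3OfK Lc (coDressKBmAt (toSite (ctrOff (d + 1) Lc)) Lc (KInvStep (d := d) Lc j))
              (fun κ u => comp (comp (trK (psiKS (ctrOff (d + 1) Lc) Lc)) (slotPsiS (ctrOff (d + 1) Lc) Lc (ScombOf (symTablesAn1S2 d Lc cΛt) cE cVH cΛ j) κ u)) (psiKS (ctrOff (d + 1) Lc) Lc)) κ t) κ u)) (psiKS (ctrOff (d + 1) Lc) Lc))) κ u) := fun κ u => ⟨_, _, _, _, hδ, hVE κ u⟩
  have hLW : ∀ (κ : Fin (d + 1)) (u : Site (d + 1)), Loc (vertexOfK (unitK sf sm (coDressKBmAt (toSite (ctrOff (d + 1) Lc)) Lc (KInvStep (d := d) Lc (j + 1)))) Lc (unitS sf sm (fun κ u => comp (comp (trK (psiKS (ctrOff (d + 1) Lc) Lc)) (slotPsiS (ctrOff (d + 1) Lc) Lc (fun κ u => (cVH * wVH d Lc (j + 1)) • (symTablesAn1S2 d Lc cΛt).V κ u) κ u)) (psiKS (ctrOff (d + 1) Lc) Lc))) κ u) := fun κ u => ⟨_, _, _, _, hδ, hVW κ u⟩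
  have hLM : ∀ (κ : Fin (d + 1)) (u : Site (d + 1)), Loc (vertexOfM (unitK sf sm (coDressKBmAt (toSite (ctrOff (d + 1) Lc)) Lc (KInvStep (d := d) Lc (j + 1)))) Lc (fun ρ w => comp (comp (trK (psiKS (ctrOff (d + 1) Lc) Lc)) (unitM sf sm ((symTablesAn1S2 d Lc cΛt).M (j + 1)) ρ w)) (psiKS (ctrOff (d + 1) Lc) Lc)) κ u) := fun κ u => ⟨_, _, _, _, hδ, hVM κ u⟩
  have hρα : ∀ y : Site (d + 1), |(if y α % (Lc : ℤ) = (Lc : ℤ) - 1 then (1 : ℝ) else 0)| ≤ 1 := fun y => by split_ifs <;> simp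
  have hρβ : ∀ w : Site (d + 1), |(if w β % (Lc : ℤ) = (Lc : ℤ) - 1 then (1 : ℝ) else 0)| ≤ 1 := fun w => by split_ifs <;> simp
  -- covariances of the three sectors
  have hWt : ∀ (κ : Fin (d + 1)) (u t : Site (d + 1)), (fun κ t => (cE * wE d Lc (j + 1)) • e3OfK Lc (coDressKBmAt (toSite (ctrOff (d + 1) Lc)) Lc (KInvStep (d := d) Lc j))
              (fun κ u => comp (comp (trK (psiKS (ctrOff (d + 1) Lc) Lc)) (slotPsiS (ctrOff (d + 1) Lc) Lc (ScombOf (symTablesAn1S2 d Lc cΛt) cE cVH cΛ j) κ u)) (psiKS (ctrOff (d + 1) Lc) Lc)) κ t) κ (u + (Lc : ℤ) • t) = shiftK (-((Lc : ℤ) • t)) ((fun κ t => (cE * wE d Lc (j + 1)) • e3OfK Lc (coDressKBmAt (toSite (ctrOff (d + 1) Lc)) Lc (KInvStep (d := d) Lc j))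
              (fun κ u => comp (comp (trK (psiKS (ctrOff (d + 1) Lc) Lc)) (slotPsiS (ctrOff (d + 1) Lc) Lc (ScombOf (symTablesAn1S2 d Lc cΛt) cE cVH cΛ j) κ u)) (psiKS (ctrOff (d + 1) Lc) Lc)) κ t) κ u) :=
    fun κ u t => sector_translate (rb := ctrOff (d + 1) Lc) (d := d) (cE * wE d Lc (j + 1)) j hMct κ u ((Lc : ℤ) • t)
  have hEcov : ∀ (κ : Fin (d + 1)) (u t : Site (d + 1)), vertexOfK (unitK sf sm (coDressKBmAt (toSite (ctrOff (d + 1) Lc)) Lc (KInvStep (d := d) Lc (j + 1)))) Lc (unitS sf sm (fun κ u => comp (comp (trK (psiKS (ctrOff (d + 1) Lc) Lc)) (slotPsiS (ctrOff (d + 1) Lc) Lc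
            (fun κ t => (cE * wE d Lc (j + 1)) • e3OfK Lc (coDressKBmAt (toSite (ctrOff (d + 1) Lc)) Lc (KInvStep (d := d) Lc j))
              (fun κ u => comp (comp (trK (psiKS (ctrOff (d + 1) Lc) Lc)) (slotPsiS (ctrOff (d + 1) Lc) Lc (ScombOf (symTablesAn1S2 d Lc cΛt) cE cVH cΛ j) κ u)) (psiKS (ctrOff (d + 1) Lc) Lc)) κ t) κ u)) (psiKS (ctrOff (d + 1) Lc) Lc))) κ (u + t) = shiftK (-((Lc : ℤ) • t)) (vertexOfK (unitK sf sm (coDressKBmAt (toSite (ctrOff (d + 1) Lc)) Lc (KInvStep (d := d) Lc (j + 1)))) Lc (unitS sf sm (fun κ u => comp (comp (trK (psiKS (ctrOff (d + 1) Lc) Lc)) (slotPsiS (ctrOff (d + 1) Lc) Lc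
            (fun κ t => (cE * wE d Lc (j + 1)) • e3OfK Lc (coDressKBmAt (toSite (ctrOff (d + 1) Lc)) Lc (KInvStep (d := d) Lc j))
              (fun κ u => comp (comp (trK (psiKS (ctrOff (d + 1) Lc) Lc)) (slotPsiS (ctrOff (d + 1) Lc) Lc (ScombOf (symTablesAn1S2 d Lc cΛt) cE cVH cΛ j) κ u)) (psiKS (ctrOff (d + 1) Lc) Lc)) κ t) κ u)) (psiKS (ctrOff (d + 1) Lc) Lc))) κ u) :=
    fun κ u t => borderSlot_translate (r := ctrOff (d + 1) Lc) hLc sf sm (j + 1) (transport_translate_comb (Lc := Lc) hWt) κ u t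
  have hWcov : ∀ (κ : Fin (d + 1)) (u t : Site (d + 1)), vertexOfK (unitK sf sm (coDressKBmAt (toSite (ctrOff (d + 1) Lc)) Lc (KInvStep (d := d) Lc (j + 1)))) Lc (unitS sf sm (fun κ u => comp (comp (trK (psiKS (ctrOff (d + 1) Lc) Lc)) (slotPsiS (ctrOff (d + 1) Lc) Lc (fun κ u => (cVH * wVH d Lc (j + 1)) • (symTablesAn1S2 d Lc cΛt).V κ u) κ u)) (psiKS (ctrOff (d + 1) Lc) Lc))) κ (u + t) = shiftK (-((Lc : ℤ) • t)) (vertexOfK (unitK sf sm (coDressKBmAt (toSite (ctrOff (d + 1) Lc)) Lc (KInvStep (d := d) Lc (j + 1)))) Lc (unitS sf sm (fun κ u => comp (comp (trK (psiKS (ctrOff (d + 1) Lc) Lc)) (slotPsiS (ctrOff (d + 1) Lc) Lc (fun κ u => (cVH * wVH d Lc (j + 1)) • (symTablesAn1S2 d Lc cΛt).V κ u) κ u)) (psiKS (ctrOff (d + 1) Lc) Lc))) κ u) :=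
    fun κ u t => borderSlot_translate (r := ctrOff (d + 1) Lc) hLc sf sm (j + 1) (transport_translate_comb (Lc := Lc) (fun κ' u' t' => VH_translate (symTablesAn1S2 d Lc cΛt) (cVH * wVH d Lc (j + 1)) κ' u' t')) κ u t
  have hWEcov : ∀ (κ : Fin (d + 1)) (u t : Site (d + 1)), vertexOfK (unitK sf sm (coDressKBmAt (toSite (ctrOff (d + 1) Lc)) Lc (KInvStep (d := d) Lc (j + 1)))) Lc (unitS sf sm (fun κ t => (cE * wE d Lc (j + 1)) • e3OfK Lc (coDressKBmAt (toSite (ctrOff (d + 1) Lc)) Lc (KInvStep (d := d) Lc j))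
              (fun κ u => comp (comp (trK (psiKS (ctrOff (d + 1) Lc) Lc)) (slotPsiS (ctrOff (d + 1) Lc) Lc (ScombOf (symTablesAn1S2 d Lc cΛt) cE cVH cΛ j) κ u)) (psiKS (ctrOff (d + 1) Lc) Lc)) κ t)) κ (u + t) = shiftK (-((Lc : ℤ) • t)) (vertexOfK (unitK sf sm (coDressKBmAt (toSite (ctrOff (d + 1) Lc)) Lc (KInvStep (d := d) Lc (j + 1)))) Lc (unitS sf sm (fun κ t => (cE * wE d Lc (j + 1)) • e3OfK Lc (coDressKBmAt (toSite (ctrOff (d + 1) Lc)) Lc (KInvStep (d := d) Lc j))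
              (fun κ u => comp (comp (trK (psiKS (ctrOff (d + 1) Lc) Lc)) (slotPsiS (ctrOff (d + 1) Lc) Lc (ScombOf (symTablesAn1S2 d Lc cΛt) cE cVH cΛ j) κ u)) (psiKS (ctrOff (d + 1) Lc) Lc)) κ t)) κ u) :=
    fun κ u t => vertexSector_translate (rb := ctrOff (d + 1) Lc) hLc sf sm (cE * wE d Lc (j + 1)) j hMct κ u t
  -- (D)_comb BY NAME (leaf-01 g87's K §3), all slot ∕ face directions, the kernel root respelled
  have hD : ∀ (κ₀ γ : Fin (d + 1)) (p : Site (d + 1)), ∑ b : Fin (d + 1),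
      ((∑' uw : Site (d + 1) × Site (d + 1), (if uw.2 γ % (Lc : ℤ) = (Lc : ℤ) - 1 then (1 : ℝ) else 0) *
          vertexOfK (unitK sf sm (coDressKBmAt (toSite (ctrOff (d + 1) Lc)) Lc (KInvStep (d := d) Lc (j + 1)))) Lc (unitS sf sm (fun κ t => (cE * wE d Lc (j + 1)) • e3OfK Lc (coDressKBmAt (toSite (ctrOff (d + 1) Lc)) Lc (KInvStep (d := d) Lc j))
              (fun κ u => comp (comp (trK (psiKS (ctrOff (d + 1) Lc) Lc)) (slotPsiS (ctrOff (d + 1) Lc) Lc (ScombOf (symTablesAn1S2 d Lc cΛt) cE cVH cΛ j) κ u)) (psiKS (ctrOff (d + 1) Lc) Lc)) κ t)) κ₀ uw.1 p uw.2 (Sum.inl b) (Sum.inl γ)) -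
       (∑' uw : Site (d + 1) × Site (d + 1), (if uw.2 γ % (Lc : ℤ) = (Lc : ℤ) - 1 then (1 : ℝ) else 0) *
          vertexOfK (unitK sf sm (coDressKBmAt (toSite (ctrOff (d + 1) Lc)) Lc (KInvStep (d := d) Lc (j + 1)))) Lc (unitS sf sm (fun κ t => (cE * wE d Lc (j + 1)) • e3OfK Lc (coDressKBmAt (toSite (ctrOff (d + 1) Lc)) Lc (KInvStep (d := d) Lc j))
              (fun κ u => comp (comp (trK (psiKS (ctrOff (d + 1) Lc) Lc)) (slotPsiS (ctrOff (d + 1) Lc) Lc (ScombOf (symTablesAn1S2 d Lc cΛt) cE cVH cΛ j) κ u)) (psiKS (ctrOff (d + 1) Lc) Lc)) κ t)) κ₀ uw.1 (p - unitVec b) uw.2 (Sum.inl b) (Sum.inl γ))) = 0 :=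
    fun κ₀ γ p => comb_exitFace_pairCurrent_divFree (d := d) (Lc := Lc) sf sm cΛt cE cVH cΛ (cE * wE d Lc (j + 1)) j κ₀ γ p
  -- the sector split in both slots (F6, respelled)
  have hsplit : ∀ (κ₀ : Fin (d + 1)) (y : Site (d + 1)), dM (unitK sf sm (coDressKBmAt (toSite (ctrOff (d + 1) Lc)) Lc (KInvStep (d := d) Lc (j + 1)))) Lc
            (fun κ u => comp (comp (trK (psiKS (ctrOff (d + 1) Lc) Lc)) (slotPsiS (ctrOff (d + 1) Lc) Lc (unitS sf sm (SpureCombOf (symTablesAn1S2 d Lc cΛt) cE cVH cΛ (j + 1))) κ u)) (psiKS (ctrOff (d + 1) Lc) Lc))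
            (fun ρ w => comp (comp (trK (psiKS (ctrOff (d + 1) Lc) Lc)) (unitM sf sm ((symTablesAn1S2 d Lc cΛt).M (j + 1)) ρ w)) (psiKS (ctrOff (d + 1) Lc) Lc)) κ₀ y
      = vertexOfK (unitK sf sm (coDressKBmAt (toSite (ctrOff (d + 1) Lc)) Lc (KInvStep (d := d) Lc (j + 1)))) Lc (unitS sf sm (fun κ u => comp (comp (trK (psiKS (ctrOff (d + 1) Lc) Lc)) (slotPsiS (ctrOff (d + 1) Lc) Lc
            (fun κ t => (cE * wE d Lc (j + 1)) • e3OfK Lc (coDressKBmAt (toSite (ctrOff (d + 1) Lc)) Lc (KInvStep (d := d) Lc j))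
              (fun κ u => comp (comp (trK (psiKS (ctrOff (d + 1) Lc) Lc)) (slotPsiS (ctrOff (d + 1) Lc) Lc (ScombOf (symTablesAn1S2 d Lc cΛt) cE cVH cΛ j) κ u)) (psiKS (ctrOff (d + 1) Lc) Lc)) κ t) κ u)) (psiKS (ctrOff (d + 1) Lc) Lc))) κ₀ y + (vertexOfK (unitK sf sm (coDressKBmAt (toSite (ctrOff (d + 1) Lc)) Lc (KInvStep (d := d) Lc (j + 1)))) Lc (unitS sf sm (fun κ u => comp (comp (trK (psiKS (ctrOff (d + 1) Lc) Lc)) (slotPsiS (ctrOff (d + 1) Lc) Lc (fun κ u => (cVH * wVH d Lc (j + 1)) • (symTablesAn1S2 d Lc cΛt).V κ u) κ u)) (psiKS (ctrOff (d + 1) Lc) Lc))) κ₀ y + vertexOfM (unitK sf sm (coDressKBmAt (toSite (ctrOff (d + 1) Lc)) Lc (KInvStep (d := d) Lc (j + 1)))) Lc (fun ρ w => comp (comp (trK (psiKS (ctrOff (d + 1) Lc) Lc)) (unitM sf sm ((symTablesAn1S2 d Lc cΛt).M (j + 1)) ρ w)) (psiKS (ctrOff (d + 1) Lc) Lc)) κ₀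 y) :=
    fun κ₀ y => dM_comb_succ_split (symTablesAn1S2 d Lc cΛt) sf sm cE cVH cΛ j hXd hδ (fun ρ w => comp (comp (trK (psiKS (ctrOff (d + 1) Lc) Lc)) (unitM sf sm ((symTablesAn1S2 d Lc cΛt).M (j + 1)) ρ w)) (psiKS (ctrOff (d + 1) Lc) Lc)) κ₀ y
  obtain ⟨Cs, δs, hδs, hS⟩ := exists_locStencil_transport_symVhS (d := d) (Lc := Lc) (cVH * wVH d Lc (j + 1))
  -- split both slots and the lattice sum
  simp only [hsplit]
  rw [Finset.sum_congr rfl fun c _ => tsum_direct_word_split (hLE μ (toSite c)) (hLW μ (toSite c)) (hLM μ (toSite c)) hX hVE hδ hVW hδ hVM hδ hρα hρβ ν (Sum.inl α) (Sum.inl β)]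
  simp only [Finset.sum_add_distrib]
  -- the nine sector words
  have z11 := sum_box_transported_sector_ee_word_eq (μ := μ) (ν := ν) (α := α) (β := β) hLc hr0 hr0 sf sm (cE * wE d Lc (j + 1)) j hMc hδMc hMct
  have z12 := sum_box_transported_sector_border_word_eq_zero_of_divFree (μ := μ) (ν := ν) (α := α) (β := β) hLc hr0 hr0 sf sm (cE * wE d Lc (j + 1)) j hMc hδMc hMct hMcp
    (locStencil_symVhS (Lc := Lc) (cVH * wVH d Lc (j + 1)) zero_le_one) one_pos (fun κ' t x z α' a => symVhS_inl_inl (Lc := Lc) (cVH * wVH d Lc (j + 1)) κ' t x z α' a)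
    (fun κ u t => symVhS_translate hLc (cVH * wVH d Lc (j + 1)) κ u t) (fun κ t z w m b hz => symVhS_inr_fst_eq_zero (Lc := Lc) (cVH * wVH d Lc (j + 1)) κ t z w m b hz) (hD μ α) (hZ μ α)
  have z13 : ∀ c : Site (d + 1), _ := fun c => tsum_right_vertexOfM_word_eq_zero hLc hr0 sf sm (j + 1) hM hδM (hLE μ c) hρα hρβ ν (Sum.inl α) (Sum.inl β)
  have z21 : ∀ c : Site (d + 1), _ := fun c => tsum_transported_noFF_sector_word_eq_zero_of_divFree (μ := μ) (ν := ν) (α := α) (β := β) hLc hr0 hr0 sf sm (cE * wE d Lc (j + 1)) j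
    (locStencil_symVhS (Lc := Lc) (cVH * wVH d Lc (j + 1)) zero_le_one) one_pos (fun κ' t x z α' a => symVhS_inl_inl (Lc := Lc) (cVH * wVH d Lc (j + 1)) κ' t x z α' a) hMc hδMc hMct c
    (hD ν β) (hZ ν β)
  have z22 := (sum_box_border_border_words_eq_zero (μ := μ) (ν := ν) (α := α) (β := β) (ρ₁ := (fun y : Site (d + 1) => (if y α % (Lc : ℤ) = (Lc : ℤ) - 1 then (1 : ℝ) else 0))) (ρ₂ := (fun w : Site (d + 1) => (if w β % (Lc : ℤ) = (Lc : ℤ) - 1 then (1 : ℝ) else 0)))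
    hLc hr0 sf sm (j + 1) hS hδs (transport_inl_inl (ctrOff (d + 1) Lc) (fun κ' t x z α' a => symVhS_inl_inl (Lc := Lc) (cVH * wVH d Lc (j + 1)) κ' t x z α' a))
    (transport_translate (ctrOff (d + 1) Lc) pos_Lc (fun κ u t => symVhS_translate hLc (cVH * wVH d Lc (j + 1)) κ u t))
    (transport_inr_fst_eq_zero (ctrOff (d + 1) Lc) (fun κ t z w m b hz => symVhS_inr_fst_eq_zero (Lc := Lc) (cVH * wVH d Lc (j + 1)) κ t z w m b hz))
    (transport_inr_snd_eq_zero (ctrOff (d + 1) Lc) (fun κ t z w a m hw => symVhS_inr_snd_eq_zero (Lc := Lc) (cVH * wVH d Lc (j + 1)) κ t z w a m hw))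
    hρα hρβ (fun y s => face_weight_periodic Lc α y s) (fun w s => face_weight_periodic Lc β w s) Lc).1
  have z23 : ∀ c : Site (d + 1), _ := fun c => tsum_right_vertexOfM_word_eq_zero hLc hr0 sf sm (j + 1) hM hδM (hLW μ c) hρα hρβ ν (Sum.inl α) (Sum.inl β)
  have z31 : ∀ c : Site (d + 1), _ := fun c => tsum_vertexOfM_left_cov_word_eq_zero hLc hr0 sf sm (j + 1) hM hδM hMcov hVE hδ hEcov
    (fun y s => face_weight_periodic Lc α y s) (fun w s => face_weight_periodic Lc β w s) hρα hρβ μ ν (Sum.inl α) (Sum.inl β) c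
  have z32 : ∀ c : Site (d + 1), _ := fun c => tsum_vertexOfM_left_cov_word_eq_zero hLc hr0 sf sm (j + 1) hM hδM hMcov hVW hδ hWcov
    (fun y s => face_weight_periodic Lc α y s) (fun w s => face_weight_periodic Lc β w s) hρα hρβ μ ν (Sum.inl α) (Sum.inl β) c
  have z33 : ∀ c : Site (d + 1), _ := fun c => tsum_right_vertexOfM_word_eq_zero hLc hr0 sf sm (j + 1) hM hδM (hLM μ c) hρα hρβ ν (Sum.inl α) (Sum.inl β)
  simp only [z13, z23, z31, z32, z33, Finset.sum_const_zero, add_zero]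
  simp only [symTablesAn1S2_V, z12, z21, z22, Finset.sum_const_zero, add_zero]
  exact z11

/-- NOT IN PRINT; OUR BOOKKEEPING ([folklore]; 30's SWAP WORD AT THE COMB DATA, LEVEL `j+1`, GIVEN (Z)_comb).  **THE SWAP EXCHANGE WORD OF THE COMB FORCING'S ff ZERO MODE AT LEVEL `j+1` IS
THE SWAP `E ⊗ E` WORD OVER THE UNTRANSPORTED COMB CUBIC SECTOR**:
`Σ_{c∈box Lc} Σ'_{u′} FF[(dM X̃_{j+1} Lc 𝒯S̃′_{j+1} 𝒯′M̃′_{j+1} ν u′ ∘ X̃_{j+1}) ∘ dM … μ c] = Σ_{c∈box Lc} Σ'_{u′} FF[(V^W_{ν,u′} ∘ X̃_{j+1}) ∘ V^W_{μ,c}]` — 30's `tsum_swap_word_split`; the `E′⊗E′` swap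
word moves its lattice bond to the right slot by joint covariance (22 `tsum_eq_tsum_of_cov ∕ twoFace_word_cov_of`), drops its transport (Y0 with `(μ, ν)` exchanged) and moves the bond back
(C `vertexSector_translate`); C's swap (`E′_{u′}⊗VH′_c` ⟸ (D)(Z) at `(ν, α)`), X2 (`VH′_{u′}⊗E′_c` ⟸ (D)(Z) at `(μ, β)`), 28's swap on F3's sockets, 23's multiplier zeros; (D) := K §3. -/
theorem sum_box_comb_swap_word_succ_eq (sf sm cΛt cE cVH cΛ : ℝ) (j : ℕ)
    (hZ : ∀ (κ₀ γ b : Fin (d + 1)), ∑ r' ∈ box (d + 1) Lc, ∑' uw : Site (d + 1) × Site (d + 1), (if uw.2 γ % (Lc : ℤ) = (Lc : ℤ) - 1 then (1 : ℝ) else 0) *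
        vertexOfK (unitK sf sm (coDressKBmAt (toSite (ctrOff (d + 1) Lc)) Lc (KInvStep (d := d) Lc (j + 1)))) Lc (unitS sf sm (fun κ t => (cE * wE d Lc (j + 1)) • e3OfK Lc (coDressKBmAt (toSite (ctrOff (d + 1) Lc)) Lc (KInvStep (d := d) Lc j))
              (fun κ u => comp (comp (trK (psiKS (ctrOff (d + 1) Lc) Lc)) (slotPsiS (ctrOff (d + 1) Lc) Lc (ScombOf (symTablesAn1S2 d Lc cΛt) cE cVH cΛ j) κ u)) (psiKS (ctrOff (d + 1) Lc) Lc)) κ t)) κ₀ uw.1 (toSite r') uw.2 (Sum.inl b) (Sum.inl γ) = 0) :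
    ∑ c ∈ box (d + 1) Lc, ∑' u' : Site (d + 1), ∑' yw : Site (d + 1) × Site (d + 1), (if yw.1 α % (Lc : ℤ) = (Lc : ℤ) - 1 then (1 : ℝ) else 0) * (if yw.2 β % (Lc : ℤ) = (Lc : ℤ) - 1 then (1 : ℝ) else 0) *
        comp (comp (dM (unitK sf sm (coDressKBmAt (toSite (ctrOff (d + 1) Lc)) Lc (KInvStep (d := d) Lc (j + 1)))) Lc
            (fun κ u => comp (comp (trK (psiKS (ctrOff (d + 1) Lc) Lc)) (slotPsiS (ctrOff (d + 1) Lc) Lc (unitS sf sm (SpureCombOf (symTablesAn1S2 d Lc cΛt) cE cVH cΛ (j + 1))) κ u)) (psiKS (ctrOff (d + 1) Lc) Lc))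
            (fun ρ w => comp (comp (trK (psiKS (ctrOff (d + 1) Lc) Lc)) (unitM sf sm ((symTablesAn1S2 d Lc cΛt).M (j + 1)) ρ w)) (psiKS (ctrOff (d + 1) Lc) Lc)) ν u') (unitK sf sm (coDressKBmAt (toSite (ctrOff (d + 1) Lc)) Lc (KInvStep (d := d) Lc (j + 1)))))
          (dM (unitK sf sm (coDressKBmAt (toSite (ctrOff (d + 1) Lc)) Lc (KInvStep (d := d) Lc (j + 1)))) Lc
            (fun κ u => comp (comp (trK (psiKS (ctrOff (d + 1) Lc) Lc)) (slotPsiS (ctrOff (d + 1) Lc) Lc (unitS sf sm (SpureCombOf (symTablesAn1S2 d Lc cΛt) cE cVH cΛ (j + 1))) κ u)) (psiKS (ctrOff (d + 1) Lc) Lc))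
            (fun ρ w => comp (comp (trK (psiKS (ctrOff (d + 1) Lc) Lc)) (unitM sf sm ((symTablesAn1S2 d Lc cΛt).M (j + 1)) ρ w)) (psiKS (ctrOff (d + 1) Lc) Lc)) μ (toSite c)) yw.1 yw.2 (Sum.inl α) (Sum.inl β) =
      ∑ c ∈ box (d + 1) Lc, ∑' u' : Site (d + 1), ∑' yw : Site (d + 1) × Site (d + 1), (if yw.1 α % (Lc : ℤ) = (Lc : ℤ) - 1 then (1 : ℝ) else 0) * (if yw.2 β % (Lc : ℤ) = (Lc : ℤ) - 1 then (1 : ℝ) else 0) *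
        comp (comp (vertexOfK (unitK sf sm (coDressKBmAt (toSite (ctrOff (d + 1) Lc)) Lc (KInvStep (d := d) Lc (j + 1)))) Lc (unitS sf sm (fun κ t => (cE * wE d Lc (j + 1)) • e3OfK Lc (coDressKBmAt (toSite (ctrOff (d + 1) Lc)) Lc (KInvStep (d := d) Lc j))
              (fun κ u => comp (comp (trK (psiKS (ctrOff (d + 1) Lc) Lc)) (slotPsiS (ctrOff (d + 1) Lc) Lc (ScombOf (symTablesAn1S2 d Lc cΛt) cE cVH cΛ j) κ u)) (psiKS (ctrOff (d + 1) Lc) Lc)) κ t)) ν u') (unitK sf sm (coDressKBmAt (toSite (ctrOff (d + 1) Lc)) Lc (KInvStep (d := d) Lc (j + 1)))))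
          (vertexOfK (unitK sf sm (coDressKBmAt (toSite (ctrOff (d + 1) Lc)) Lc (KInvStep (d := d) Lc (j + 1)))) Lc (unitS sf sm (fun κ t => (cE * wE d Lc (j + 1)) • e3OfK Lc (coDressKBmAt (toSite (ctrOff (d + 1) Lc)) Lc (KInvStep (d := d) Lc j))
              (fun κ u => comp (comp (trK (psiKS (ctrOff (d + 1) Lc) Lc)) (slotPsiS (ctrOff (d + 1) Lc) Lc (ScombOf (symTablesAn1S2 d Lc cΛt) cE cVH cΛ j) κ u)) (psiKS (ctrOff (d + 1) Lc) Lc)) κ t)) μ (toSite c)) yw.1 yw.2 (Sum.inl α) (Sum.inl β) := by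
  classical
  have hLc : 1 ≤ Lc := Nat.one_le_iff_ne_zero.mpr (NeZero.ne Lc)
  have hr0 := ctrOff_mem_box (d := d + 1) (pos_Lc (Lc := Lc))
  -- the transported folded comb member `𝒯 S̃comb_j` (C §3) and the transported multiplier family (F2 ∕ F5)
  obtain ⟨CMc, δMc, hδMc, hMc⟩ := exists_locStencil_transport_ScombOf (d := d) (Lc := Lc) cΛt cE cVH cΛ j
  have hMct := fun (κ : Fin (d + 1)) (u t : Site (d + 1)) => transport_ScombOf_translate (d := d) (Lc := Lc) cΛt cE cVH cΛ j κ u t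
  have hMcp := fun (κ : Fin (d + 1)) (u : Site (d + 1)) => parityOdd_transport_ScombOf (d := d) (Lc := Lc) cΛt cE cVH cΛ j κ u
  obtain ⟨CM, δM, hδM, hM⟩ := exists_vertexFamily_transport_M (symTablesAn1S2 d Lc cΛt) sf sm (j + 1)
  have hMcov := transportM_translate (symTablesAn1S2 d Lc cΛt) sf sm (j + 1)
  -- one rate for the three level-(j+1) comb sectors (F6, the kernel root respelled `toSite (ctrOff (d+1) Lc)`)
  obtain ⟨δ, CX, Cv, Cw, Cm, hδ, hXd, hVE, hVW, hVM⟩ : ∃ δ CX Cv Cw Cm : ℝ, 0 < δ ∧ Decays (unitK sf sm (coDressKBmAt (toSite (ctrOff (d + 1) Lc)) Lc (KInvStep (d := d) Lc (j + 1)))) CX δ ∧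
      VertexFamily (vertexOfK (unitK sf sm (coDressKBmAt (toSite (ctrOff (d + 1) Lc)) Lc (KInvStep (d := d) Lc (j + 1)))) Lc (unitS sf sm (fun κ u => comp (comp (trK (psiKS (ctrOff (d + 1) Lc) Lc)) (slotPsiS (ctrOff (d + 1) Lc) Lc
            (fun κ t => (cE * wE d Lc (j + 1)) • e3OfK Lc (coDressKBmAt (toSite (ctrOff (d + 1) Lc)) Lc (KInvStep (d := d) Lc j))
              (fun κ u => comp (comp (trK (psiKS (ctrOff (d + 1) Lc) Lc)) (slotPsiS (ctrOff (d + 1) Lc) Lc (ScombOf (symTablesAn1S2 d Lc cΛt) cE cVH cΛ j) κ u)) (psiKS (ctrOff (d + 1) Lc) Lc)) κ t) κ u)) (psiKS (ctrOff (d + 1) Lc) Lc)))) Lc Cv δ ∧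
      VertexFamily (vertexOfK (unitK sf sm (coDressKBmAt (toSite (ctrOff (d + 1) Lc)) Lc (KInvStep (d := d) Lc (j + 1)))) Lc (unitS sf sm (fun κ u => comp (comp (trK (psiKS (ctrOff (d + 1) Lc) Lc)) (slotPsiS (ctrOff (d + 1) Lc) Lc (fun κ u => (cVH * wVH d Lc (j + 1)) • (symTablesAn1S2 d Lc cΛt).V κ u) κ u)) (psiKS (ctrOff (d + 1) Lc) Lc)))) Lc Cw δ ∧
      VertexFamily (vertexOfM (unitK sf sm (coDressKBmAt (toSite (ctrOff (d + 1) Lc)) Lc (KInvStep (d := d) Lc (j + 1)))) Lc (fun ρ w => comp (comp (trK (psiKS (ctrOff (d + 1) Lc) Lc)) (unitM sf sm ((symTablesAn1S2 d Lc cΛt).M (j + 1)) ρ w)) (psiKS (ctrOff (d + 1) Lc) Lc))) Lc Cm δ :=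
    exists_sector_data_comb_succ (symTablesAn1S2 d Lc cΛt) sf sm cE cVH cΛ j hM hδM
  have hX : Spr (unitK sf sm (coDressKBmAt (toSite (ctrOff (d + 1) Lc)) Lc (KInvStep (d := d) Lc (j + 1)))) := ⟨_, _, hδ, hXd⟩
  have hXs : ∀ t : Site (d + 1), shiftK (-((Lc : ℤ) • t)) (unitK sf sm (coDressKBmAt (toSite (ctrOff (d + 1) Lc)) Lc (KInvStep (d := d) Lc (j + 1)))) = unitK sf sm (coDressKBmAt (toSite (ctrOff (d + 1) Lc)) Lc (KInvStep (d := d) Lc (j + 1))) := fun t => shiftK_dressedStep (r := ctrOff (d + 1) Lc) hLc sf sm (j + 1) t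
  have hLE : ∀ (κ : Fin (d + 1)) (u : Site (d + 1)), Loc (vertexOfK (unitK sf sm (coDressKBmAt (toSite (ctrOff (d + 1) Lc)) Lc (KInvStep (d := d) Lc (j + 1)))) Lc (unitS sf sm (fun κ u => comp (comp (trK (psiKS (ctrOff (d + 1) Lc) Lc)) (slotPsiS (ctrOff (d + 1) Lc) Lc
            (fun κ t => (cE * wE d Lc (j + 1)) • e3OfK Lc (coDressKBmAt (toSite (ctrOff (d + 1) Lc)) Lc (KInvStep (d := d) Lc j))
              (fun κ u => comp (comp (trK (psiKS (ctrOff (d + 1) Lc) Lc)) (slotPsiS (ctrOff (d + 1) Lc) Lc (ScombOf (symTablesAn1S2 d Lc cΛt) cE cVH cΛ j) κ u)) (psiKS (ctrOff (d + 1) Lc) Lc)) κ t) κ u)) (psiKS (ctrOff (d + 1) Lc) Lc))) κ u) := fun κ u => ⟨_, _, _, _, hδ, hVE κ u⟩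
  have hLW : ∀ (κ : Fin (d + 1)) (u : Site (d + 1)), Loc (vertexOfK (unitK sf sm (coDressKBmAt (toSite (ctrOff (d + 1) Lc)) Lc (KInvStep (d := d) Lc (j + 1)))) Lc (unitS sf sm (fun κ u => comp (comp (trK (psiKS (ctrOff (d + 1) Lc) Lc)) (slotPsiS (ctrOff (d + 1) Lc) Lc (fun κ u => (cVH * wVH d Lc (j + 1)) • (symTablesAn1S2 d Lc cΛt).V κ u) κ u)) (psiKS (ctrOff (d + 1) Lc) Lc))) κ u) := fun κ u => ⟨_, _, _, _, hδ, hVW κ u⟩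
  have hLM : ∀ (κ : Fin (d + 1)) (u : Site (d + 1)), Loc (vertexOfM (unitK sf sm (coDressKBmAt (toSite (ctrOff (d + 1) Lc)) Lc (KInvStep (d := d) Lc (j + 1)))) Lc (fun ρ w => comp (comp (trK (psiKS (ctrOff (d + 1) Lc) Lc)) (unitM sf sm ((symTablesAn1S2 d Lc cΛt).M (j + 1)) ρ w)) (psiKS (ctrOff (d + 1) Lc) Lc)) κ u) := fun κ u => ⟨_, _, _, _, hδ, hVM κ u⟩
  have hρα : ∀ y : Site (d + 1), |(if y α % (Lc : ℤ) = (Lc : ℤ) - 1 then (1 : ℝ) else 0)| ≤ 1 := fun y => by split_ifs <;> simp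
  have hρβ : ∀ w : Site (d + 1), |(if w β % (Lc : ℤ) = (Lc : ℤ) - 1 then (1 : ℝ) else 0)| ≤ 1 := fun w => by split_ifs <;> simp
  -- covariances of the three sectors
  have hWt : ∀ (κ : Fin (d + 1)) (u t : Site (d + 1)), (fun κ t => (cE * wE d Lc (j + 1)) • e3OfK Lc (coDressKBmAt (toSite (ctrOff (d + 1) Lc)) Lc (KInvStep (d := d) Lc j))
              (fun κ u => comp (comp (trK (psiKS (ctrOff (d + 1) Lc) Lc)) (slotPsiS (ctrOff (d + 1) Lc) Lc (ScombOf (symTablesAn1S2 d Lc cΛt) cE cVH cΛ j) κ u)) (psiKS (ctrOff (d + 1) Lc) Lc)) κ t) κ (u + (Lc : ℤ) • t) = shiftK (-((Lc : ℤ) • t)) ((fun κ t => (cE * wE d Lc (j + 1)) • e3OfK Lc (coDressKBmAt (toSite (ctrOff (d + 1) Lc)) Lc (KInvStep (d := d) Lc j))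
              (fun κ u => comp (comp (trK (psiKS (ctrOff (d + 1) Lc) Lc)) (slotPsiS (ctrOff (d + 1) Lc) Lc (ScombOf (symTablesAn1S2 d Lc cΛt) cE cVH cΛ j) κ u)) (psiKS (ctrOff (d + 1) Lc) Lc)) κ t) κ u) :=
    fun κ u t => sector_translate (rb := ctrOff (d + 1) Lc) (d := d) (cE * wE d Lc (j + 1)) j hMct κ u ((Lc : ℤ) • t)
  have hEcov : ∀ (κ : Fin (d + 1)) (u t : Site (d + 1)), vertexOfK (unitK sf sm (coDressKBmAt (toSite (ctrOff (d + 1) Lc)) Lc (KInvStep (d := d) Lc (j + 1)))) Lc (unitS sf sm (fun κ u => comp (comp (trK (psiKS (ctrOff (d + 1) Lc) Lc)) (slotPsiS (ctrOff (d + 1) Lc) Lc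
            (fun κ t => (cE * wE d Lc (j + 1)) • e3OfK Lc (coDressKBmAt (toSite (ctrOff (d + 1) Lc)) Lc (KInvStep (d := d) Lc j))
              (fun κ u => comp (comp (trK (psiKS (ctrOff (d + 1) Lc) Lc)) (slotPsiS (ctrOff (d + 1) Lc) Lc (ScombOf (symTablesAn1S2 d Lc cΛt) cE cVH cΛ j) κ u)) (psiKS (ctrOff (d + 1) Lc) Lc)) κ t) κ u)) (psiKS (ctrOff (d + 1) Lc) Lc))) κ (u + t) = shiftK (-((Lc : ℤ) • t)) (vertexOfK (unitK sf sm (coDressKBmAt (toSite (ctrOff (d + 1) Lc)) Lc (KInvStep (d := d) Lc (j + 1)))) Lc (unitS sf sm (fun κ u => comp (comp (trK (psiKS (ctrOff (d + 1) Lc) Lc)) (slotPsiS (ctrOff (d + 1) Lc) Lc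
            (fun κ t => (cE * wE d Lc (j + 1)) • e3OfK Lc (coDressKBmAt (toSite (ctrOff (d + 1) Lc)) Lc (KInvStep (d := d) Lc j))
              (fun κ u => comp (comp (trK (psiKS (ctrOff (d + 1) Lc) Lc)) (slotPsiS (ctrOff (d + 1) Lc) Lc (ScombOf (symTablesAn1S2 d Lc cΛt) cE cVH cΛ j) κ u)) (psiKS (ctrOff (d + 1) Lc) Lc)) κ t) κ u)) (psiKS (ctrOff (d + 1) Lc) Lc))) κ u) :=
    fun κ u t => borderSlot_translate (r := ctrOff (d + 1) Lc) hLc sf sm (j + 1) (transport_translate_comb (Lc := Lc) hWt) κ u t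
  have hWcov : ∀ (κ : Fin (d + 1)) (u t : Site (d + 1)), vertexOfK (unitK sf sm (coDressKBmAt (toSite (ctrOff (d + 1) Lc)) Lc (KInvStep (d := d) Lc (j + 1)))) Lc (unitS sf sm (fun κ u => comp (comp (trK (psiKS (ctrOff (d + 1) Lc) Lc)) (slotPsiS (ctrOff (d + 1) Lc) Lc (fun κ u => (cVH * wVH d Lc (j + 1)) • (symTablesAn1S2 d Lc cΛt).V κ u) κ u)) (psiKS (ctrOff (d + 1) Lc) Lc))) κ (u + t) = shiftK (-((Lc : ℤ) • t)) (vertexOfK (unitK sf sm (coDressKBmAt (toSite (ctrOff (d + 1) Lc)) Lc (KInvStep (d := d) Lc (j + 1)))) Lc (unitS sf sm (fun κ u => comp (comp (trK (psiKS (ctrOff (d + 1) Lc) Lc)) (slotPsiS (ctrOff (d + 1) Lc) Lc (fun κ u => (cVH * wVH d Lc (j + 1)) • (symTablesAn1S2 d Lc cΛt).V κ u) κ u)) (psiKS (ctrOff (d + 1) Lc) Lc))) κ u) :=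
    fun κ u t => borderSlot_translate (r := ctrOff (d + 1) Lc) hLc sf sm (j + 1) (transport_translate_comb (Lc := Lc) (fun κ' u' t' => VH_translate (symTablesAn1S2 d Lc cΛt) (cVH * wVH d Lc (j + 1)) κ' u' t')) κ u t
  have hWEcov : ∀ (κ : Fin (d + 1)) (u t : Site (d + 1)), vertexOfK (unitK sf sm (coDressKBmAt (toSite (ctrOff (d + 1) Lc)) Lc (KInvStep (d := d) Lc (j + 1)))) Lc (unitS sf sm (fun κ t => (cE * wE d Lc (j + 1)) • e3OfK Lc (coDressKBmAt (toSite (ctrOff (d + 1) Lc)) Lc (KInvStep (d := d) Lc j))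
              (fun κ u => comp (comp (trK (psiKS (ctrOff (d + 1) Lc) Lc)) (slotPsiS (ctrOff (d + 1) Lc) Lc (ScombOf (symTablesAn1S2 d Lc cΛt) cE cVH cΛ j) κ u)) (psiKS (ctrOff (d + 1) Lc) Lc)) κ t)) κ (u + t) = shiftK (-((Lc : ℤ) • t)) (vertexOfK (unitK sf sm (coDressKBmAt (toSite (ctrOff (d + 1) Lc)) Lc (KInvStep (d := d) Lc (j + 1)))) Lc (unitS sf sm (fun κ t => (cE * wE d Lc (j + 1)) • e3OfK Lc (coDressKBmAt (toSite (ctrOff (d + 1) Lc)) Lc (KInvStep (d := d) Lc j))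
              (fun κ u => comp (comp (trK (psiKS (ctrOff (d + 1) Lc) Lc)) (slotPsiS (ctrOff (d + 1) Lc) Lc (ScombOf (symTablesAn1S2 d Lc cΛt) cE cVH cΛ j) κ u)) (psiKS (ctrOff (d + 1) Lc) Lc)) κ t)) κ u) :=
    fun κ u t => vertexSector_translate (rb := ctrOff (d + 1) Lc) hLc sf sm (cE * wE d Lc (j + 1)) j hMct κ u t
  -- (D)_comb BY NAME (leaf-01 g87's K §3), all slot ∕ face directions, the kernel root respelled
  have hD : ∀ (κ₀ γ : Fin (d + 1)) (p : Site (d + 1)), ∑ b : Fin (d + 1),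
      ((∑' uw : Site (d + 1) × Site (d + 1), (if uw.2 γ % (Lc : ℤ) = (Lc : ℤ) - 1 then (1 : ℝ) else 0) *
          vertexOfK (unitK sf sm (coDressKBmAt (toSite (ctrOff (d + 1) Lc)) Lc (KInvStep (d := d) Lc (j + 1)))) Lc (unitS sf sm (fun κ t => (cE * wE d Lc (j + 1)) • e3OfK Lc (coDressKBmAt (toSite (ctrOff (d + 1) Lc)) Lc (KInvStep (d := d) Lc j))
              (fun κ u => comp (comp (trK (psiKS (ctrOff (d + 1) Lc) Lc)) (slotPsiS (ctrOff (d + 1) Lc) Lc (ScombOf (symTablesAn1S2 d Lc cΛt) cE cVH cΛ j) κ u)) (psiKS (ctrOff (d + 1) Lc) Lc)) κ t)) κ₀ uw.1 p uw.2 (Sum.inl b) (Sum.inl γ)) -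
       (∑' uw : Site (d + 1) × Site (d + 1), (if uw.2 γ % (Lc : ℤ) = (Lc : ℤ) - 1 then (1 : ℝ) else 0) *
          vertexOfK (unitK sf sm (coDressKBmAt (toSite (ctrOff (d + 1) Lc)) Lc (KInvStep (d := d) Lc (j + 1)))) Lc (unitS sf sm (fun κ t => (cE * wE d Lc (j + 1)) • e3OfK Lc (coDressKBmAt (toSite (ctrOff (d + 1) Lc)) Lc (KInvStep (d := d) Lc j))
              (fun κ u => comp (comp (trK (psiKS (ctrOff (d + 1) Lc) Lc)) (slotPsiS (ctrOff (d + 1) Lc) Lc (ScombOf (symTablesAn1S2 d Lc cΛt) cE cVH cΛ j) κ u)) (psiKS (ctrOff (d + 1) Lc) Lc)) κ t)) κ₀ uw.1 (p - unitVec b) uw.2 (Sum.inl b) (Sum.inl γ))) = 0 :=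
    fun κ₀ γ p => comb_exitFace_pairCurrent_divFree (d := d) (Lc := Lc) sf sm cΛt cE cVH cΛ (cE * wE d Lc (j + 1)) j κ₀ γ p
  -- the sector split in both slots (F6, respelled)
  have hsplit : ∀ (κ₀ : Fin (d + 1)) (y : Site (d + 1)), dM (unitK sf sm (coDressKBmAt (toSite (ctrOff (d + 1) Lc)) Lc (KInvStep (d := d) Lc (j + 1)))) Lc
            (fun κ u => comp (comp (trK (psiKS (ctrOff (d + 1) Lc) Lc)) (slotPsiS (ctrOff (d + 1) Lc) Lc (unitS sf sm (SpureCombOf (symTablesAn1S2 d Lc cΛt) cE cVH cΛ (j + 1))) κ u)) (psiKS (ctrOff (d + 1) Lc) Lc))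
            (fun ρ w => comp (comp (trK (psiKS (ctrOff (d + 1) Lc) Lc)) (unitM sf sm ((symTablesAn1S2 d Lc cΛt).M (j + 1)) ρ w)) (psiKS (ctrOff (d + 1) Lc) Lc)) κ₀ y
      = vertexOfK (unitK sf sm (coDressKBmAt (toSite (ctrOff (d + 1) Lc)) Lc (KInvStep (d := d) Lc (j + 1)))) Lc (unitS sf sm (fun κ u => comp (comp (trK (psiKS (ctrOff (d + 1) Lc) Lc)) (slotPsiS (ctrOff (d + 1) Lc) Lc
            (fun κ t => (cE * wE d Lc (j + 1)) • e3OfK Lc (coDressKBmAt (toSite (ctrOff (d + 1) Lc)) Lc (KInvStep (d := d) Lc j))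
              (fun κ u => comp (comp (trK (psiKS (ctrOff (d + 1) Lc) Lc)) (slotPsiS (ctrOff (d + 1) Lc) Lc (ScombOf (symTablesAn1S2 d Lc cΛt) cE cVH cΛ j) κ u)) (psiKS (ctrOff (d + 1) Lc) Lc)) κ t) κ u)) (psiKS (ctrOff (d + 1) Lc) Lc))) κ₀ y + (vertexOfK (unitK sf sm (coDressKBmAt (toSite (ctrOff (d + 1) Lc)) Lc (KInvStep (d := d) Lc (j + 1)))) Lc (unitS sf sm (fun κ u => comp (comp (trK (psiKS (ctrOff (d + 1) Lc) Lc)) (slotPsiS (ctrOff (d + 1) Lc) Lc (fun κ u => (cVH * wVH d Lc (j + 1)) • (symTablesAn1S2 d Lc cΛt).V κ u) κ u)) (psiKS (ctrOff (d + 1) Lc) Lc))) κ₀ y + vertexOfM (unitK sf sm (coDressKBmAt (toSite (ctrOff (d + 1) Lc)) Lc (KInvStep (d := d) Lc (j + 1)))) Lc (fun ρ w => comp (comp (trK (psiKS (ctrOff (d + 1) Lc) Lc)) (unitM sf sm ((symTablesAn1S2 d Lc cΛt).M (j + 1)) ρ w)) (psiKS (ctrOff (d + 1) Lc) Lc)) κ₀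 y) :=
    fun κ₀ y => dM_comb_succ_split (symTablesAn1S2 d Lc cΛt) sf sm cE cVH cΛ j hXd hδ (fun ρ w => comp (comp (trK (psiKS (ctrOff (d + 1) Lc) Lc)) (unitM sf sm ((symTablesAn1S2 d Lc cΛt).M (j + 1)) ρ w)) (psiKS (ctrOff (d + 1) Lc) Lc)) κ₀ y
  obtain ⟨Cs, δs, hδs, hS⟩ := exists_locStencil_transport_symVhS (d := d) (Lc := Lc) (cVH * wVH d Lc (j + 1))
  -- split both slots and the lattice sum
  simp only [hsplit]
  rw [Finset.sum_congr rfl fun c _ => tsum_swap_word_split (hLE μ (toSite c)) (hLW μ (toSite c)) (hLM μ (toSite c)) hX hVE hδ hVW hδ hVM hδ hρα hρβ ν (Sum.inl α) (Sum.inl β)]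
  simp only [Finset.sum_add_distrib]
  -- the nine sector words (left slot on the lattice bond)
  have swap : ∀ c : Site (d + 1), (∑' u' : Site (d + 1), ∑' yw : Site (d + 1) × Site (d + 1), (if yw.1 α % (Lc : ℤ) = (Lc : ℤ) - 1 then (1 : ℝ) else 0) * (if yw.2 β % (Lc : ℤ) = (Lc : ℤ) - 1 then (1 : ℝ) else 0) *
        comp (comp (vertexOfK (unitK sf sm (coDressKBmAt (toSite (ctrOff (d + 1) Lc)) Lc (KInvStep (d := d) Lc (j + 1)))) Lc (unitS sf sm (fun κ u => comp (comp (trK (psiKS (ctrOff (d + 1) Lc) Lc)) (slotPsiS (ctrOff (d + 1) Lc) Lc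
            (fun κ t => (cE * wE d Lc (j + 1)) • e3OfK Lc (coDressKBmAt (toSite (ctrOff (d + 1) Lc)) Lc (KInvStep (d := d) Lc j))
              (fun κ u => comp (comp (trK (psiKS (ctrOff (d + 1) Lc) Lc)) (slotPsiS (ctrOff (d + 1) Lc) Lc (ScombOf (symTablesAn1S2 d Lc cΛt) cE cVH cΛ j) κ u)) (psiKS (ctrOff (d + 1) Lc) Lc)) κ t) κ u)) (psiKS (ctrOff (d + 1) Lc) Lc))) ν u') (unitK sf sm (coDressKBmAt (toSite (ctrOff (d + 1) Lc)) Lc (KInvStep (d := d) Lc (j + 1)))))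
          (vertexOfK (unitK sf sm (coDressKBmAt (toSite (ctrOff (d + 1) Lc)) Lc (KInvStep (d := d) Lc (j + 1)))) Lc (unitS sf sm (fun κ u => comp (comp (trK (psiKS (ctrOff (d + 1) Lc) Lc)) (slotPsiS (ctrOff (d + 1) Lc) Lc
            (fun κ t => (cE * wE d Lc (j + 1)) • e3OfK Lc (coDressKBmAt (toSite (ctrOff (d + 1) Lc)) Lc (KInvStep (d := d) Lc j))
              (fun κ u => comp (comp (trK (psiKS (ctrOff (d + 1) Lc) Lc)) (slotPsiS (ctrOff (d + 1) Lc) Lc (ScombOf (symTablesAn1S2 d Lc cΛt) cE cVH cΛ j) κ u)) (psiKS (ctrOff (d + 1) Lc) Lc)) κ t) κ u)) (psiKS (ctrOff (d + 1) Lc) Lc))) μ c) yw.1 yw.2 (Sum.inl α) (Sum.inl β)) =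
      ∑' u' : Site (d + 1), ∑' yw : Site (d + 1) × Site (d + 1), (if yw.1 α % (Lc : ℤ) = (Lc : ℤ) - 1 then (1 : ℝ) else 0) * (if yw.2 β % (Lc : ℤ) = (Lc : ℤ) - 1 then (1 : ℝ) else 0) *
        comp (comp (vertexOfK (unitK sf sm (coDressKBmAt (toSite (ctrOff (d + 1) Lc)) Lc (KInvStep (d := d) Lc (j + 1)))) Lc (unitS sf sm (fun κ u => comp (comp (trK (psiKS (ctrOff (d + 1) Lc) Lc)) (slotPsiS (ctrOff (d + 1) Lc) Lc
            (fun κ t => (cE * wE d Lc (j + 1)) • e3OfK Lc (coDressKBmAt (toSite (ctrOff (d + 1) Lc)) Lc (KInvStep (d := d) Lc j))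
              (fun κ u => comp (comp (trK (psiKS (ctrOff (d + 1) Lc) Lc)) (slotPsiS (ctrOff (d + 1) Lc) Lc (ScombOf (symTablesAn1S2 d Lc cΛt) cE cVH cΛ j) κ u)) (psiKS (ctrOff (d + 1) Lc) Lc)) κ t) κ u)) (psiKS (ctrOff (d + 1) Lc) Lc))) ν c) (unitK sf sm (coDressKBmAt (toSite (ctrOff (d + 1) Lc)) Lc (KInvStep (d := d) Lc (j + 1)))))
          (vertexOfK (unitK sf sm (coDressKBmAt (toSite (ctrOff (d + 1) Lc)) Lc (KInvStep (d := d) Lc (j + 1)))) Lc (unitS sf sm (fun κ u => comp (comp (trK (psiKS (ctrOff (d + 1) Lc) Lc)) (slotPsiS (ctrOff (d + 1) Lc) Lc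
            (fun κ t => (cE * wE d Lc (j + 1)) • e3OfK Lc (coDressKBmAt (toSite (ctrOff (d + 1) Lc)) Lc (KInvStep (d := d) Lc j))
              (fun κ u => comp (comp (trK (psiKS (ctrOff (d + 1) Lc) Lc)) (slotPsiS (ctrOff (d + 1) Lc) Lc (ScombOf (symTablesAn1S2 d Lc cΛt) cE cVH cΛ j) κ u)) (psiKS (ctrOff (d + 1) Lc) Lc)) κ t) κ u)) (psiKS (ctrOff (d + 1) Lc) Lc))) μ u') yw.1 yw.2 (Sum.inl α) (Sum.inl β) :=
    fun c => tsum_eq_tsum_of_cov (G := fun a b => ∑' yw : Site (d + 1) × Site (d + 1), (if yw.1 α % (Lc : ℤ) = (Lc : ℤ) - 1 then (1 : ℝ) else 0) * (if yw.2 β % (Lc : ℤ) = (Lc : ℤ) - 1 then (1 : ℝ) else 0) *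
        comp (comp (vertexOfK (unitK sf sm (coDressKBmAt (toSite (ctrOff (d + 1) Lc)) Lc (KInvStep (d := d) Lc (j + 1)))) Lc (unitS sf sm (fun κ u => comp (comp (trK (psiKS (ctrOff (d + 1) Lc) Lc)) (slotPsiS (ctrOff (d + 1) Lc) Lc
            (fun κ t => (cE * wE d Lc (j + 1)) • e3OfK Lc (coDressKBmAt (toSite (ctrOff (d + 1) Lc)) Lc (KInvStep (d := d) Lc j))
              (fun κ u => comp (comp (trK (psiKS (ctrOff (d + 1) Lc) Lc)) (slotPsiS (ctrOff (d + 1) Lc) Lc (ScombOf (symTablesAn1S2 d Lc cΛt) cE cVH cΛ j) κ u)) (psiKS (ctrOff (d + 1) Lc) Lc)) κ t) κ u)) (psiKS (ctrOff (d + 1) Lc) Lc))) ν a) (unitK sf sm (coDressKBmAt (toSite (ctrOff (d + 1) Lc)) Lc (KInvStep (d := d) Lc (j + 1)))))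
          (vertexOfK (unitK sf sm (coDressKBmAt (toSite (ctrOff (d + 1) Lc)) Lc (KInvStep (d := d) Lc (j + 1)))) Lc (unitS sf sm (fun κ u => comp (comp (trK (psiKS (ctrOff (d + 1) Lc) Lc)) (slotPsiS (ctrOff (d + 1) Lc) Lc
            (fun κ t => (cE * wE d Lc (j + 1)) • e3OfK Lc (coDressKBmAt (toSite (ctrOff (d + 1) Lc)) Lc (KInvStep (d := d) Lc j))
              (fun κ u => comp (comp (trK (psiKS (ctrOff (d + 1) Lc) Lc)) (slotPsiS (ctrOff (d + 1) Lc) Lc (ScombOf (symTablesAn1S2 d Lc cΛt) cE cVH cΛ j) κ u)) (psiKS (ctrOff (d + 1) Lc) Lc)) κ t) κ u)) (psiKS (ctrOff (d + 1) Lc) Lc))) μ b) yw.1 yw.2 (Sum.inl α) (Sum.inl β))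
      (fun a b t => twoFace_word_cov_of (N := Lc) (fun a' t' => hEcov ν a' t') (fun b' t' => hEcov μ b' t') hXs
      (ρ₁ := (fun y : Site (d + 1) => (if y α % (Lc : ℤ) = (Lc : ℤ) - 1 then (1 : ℝ) else 0))) (ρ₂ := (fun w : Site (d + 1) => (if w β % (Lc : ℤ) = (Lc : ℤ) - 1 then (1 : ℝ) else 0)))
      (fun y s => face_weight_periodic Lc α y s) (fun w s => face_weight_periodic Lc β w s) a b t (Sum.inl α) (Sum.inl β)) c
  have swapW : ∀ c : Site (d + 1), (∑' u' : Site (d + 1), ∑' yw : Site (d + 1) × Site (d + 1), (if yw.1 α % (Lc : ℤ) = (Lc : ℤ) - 1 then (1 : ℝ) else 0) * (if yw.2 β % (Lc : ℤ) = (Lc : ℤ) - 1 then (1 : ℝ) else 0) *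
        comp (comp (vertexOfK (unitK sf sm (coDressKBmAt (toSite (ctrOff (d + 1) Lc)) Lc (KInvStep (d := d) Lc (j + 1)))) Lc (unitS sf sm (fun κ t => (cE * wE d Lc (j + 1)) • e3OfK Lc (coDressKBmAt (toSite (ctrOff (d + 1) Lc)) Lc (KInvStep (d := d) Lc j))
              (fun κ u => comp (comp (trK (psiKS (ctrOff (d + 1) Lc) Lc)) (slotPsiS (ctrOff (d + 1) Lc) Lc (ScombOf (symTablesAn1S2 d Lc cΛt) cE cVH cΛ j) κ u)) (psiKS (ctrOff (d + 1) Lc) Lc)) κ t)) ν u') (unitK sf sm (coDressKBmAt (toSite (ctrOff (d + 1) Lc)) Lc (KInvStep (d := d) Lc (j + 1)))))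
          (vertexOfK (unitK sf sm (coDressKBmAt (toSite (ctrOff (d + 1) Lc)) Lc (KInvStep (d := d) Lc (j + 1)))) Lc (unitS sf sm (fun κ t => (cE * wE d Lc (j + 1)) • e3OfK Lc (coDressKBmAt (toSite (ctrOff (d + 1) Lc)) Lc (KInvStep (d := d) Lc j))
              (fun κ u => comp (comp (trK (psiKS (ctrOff (d + 1) Lc) Lc)) (slotPsiS (ctrOff (d + 1) Lc) Lc (ScombOf (symTablesAn1S2 d Lc cΛt) cE cVH cΛ j) κ u)) (psiKS (ctrOff (d + 1) Lc) Lc)) κ t)) μ c) yw.1 yw.2 (Sum.inl α) (Sum.inl β)) =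
      ∑' u' : Site (d + 1), ∑' yw : Site (d + 1) × Site (d + 1), (if yw.1 α % (Lc : ℤ) = (Lc : ℤ) - 1 then (1 : ℝ) else 0) * (if yw.2 β % (Lc : ℤ) = (Lc : ℤ) - 1 then (1 : ℝ) else 0) *
        comp (comp (vertexOfK (unitK sf sm (coDressKBmAt (toSite (ctrOff (d + 1) Lc)) Lc (KInvStep (d := d) Lc (j + 1)))) Lc (unitS sf sm (fun κ t => (cE * wE d Lc (j + 1)) • e3OfK Lc (coDressKBmAt (toSite (ctrOff (d + 1) Lc)) Lc (KInvStep (d := d) Lc j))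
              (fun κ u => comp (comp (trK (psiKS (ctrOff (d + 1) Lc) Lc)) (slotPsiS (ctrOff (d + 1) Lc) Lc (ScombOf (symTablesAn1S2 d Lc cΛt) cE cVH cΛ j) κ u)) (psiKS (ctrOff (d + 1) Lc) Lc)) κ t)) ν c) (unitK sf sm (coDressKBmAt (toSite (ctrOff (d + 1) Lc)) Lc (KInvStep (d := d) Lc (j + 1)))))
          (vertexOfK (unitK sf sm (coDressKBmAt (toSite (ctrOff (d + 1) Lc)) Lc (KInvStep (d := d) Lc (j + 1)))) Lc (unitS sf sm (fun κ t => (cE * wE d Lc (j + 1)) • e3OfK Lc (coDressKBmAt (toSite (ctrOff (d + 1) Lc)) Lc (KInvStep (d := d) Lc j))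
              (fun κ u => comp (comp (trK (psiKS (ctrOff (d + 1) Lc) Lc)) (slotPsiS (ctrOff (d + 1) Lc) Lc (ScombOf (symTablesAn1S2 d Lc cΛt) cE cVH cΛ j) κ u)) (psiKS (ctrOff (d + 1) Lc) Lc)) κ t)) μ u') yw.1 yw.2 (Sum.inl α) (Sum.inl β) :=
    fun c => tsum_eq_tsum_of_cov (G := fun a b => ∑' yw : Site (d + 1) × Site (d + 1), (if yw.1 α % (Lc : ℤ) = (Lc : ℤ) - 1 then (1 : ℝ) else 0) * (if yw.2 β % (Lc : ℤ) = (Lc : ℤ) - 1 then (1 : ℝ) else 0) *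
        comp (comp (vertexOfK (unitK sf sm (coDressKBmAt (toSite (ctrOff (d + 1) Lc)) Lc (KInvStep (d := d) Lc (j + 1)))) Lc (unitS sf sm (fun κ t => (cE * wE d Lc (j + 1)) • e3OfK Lc (coDressKBmAt (toSite (ctrOff (d + 1) Lc)) Lc (KInvStep (d := d) Lc j))
              (fun κ u => comp (comp (trK (psiKS (ctrOff (d + 1) Lc) Lc)) (slotPsiS (ctrOff (d + 1) Lc) Lc (ScombOf (symTablesAn1S2 d Lc cΛt) cE cVH cΛ j) κ u)) (psiKS (ctrOff (d + 1) Lc) Lc)) κ t)) ν a) (unitK sf sm (coDressKBmAt (toSite (ctrOff (d + 1) Lc)) Lc (KInvStep (d := d) Lc (j + 1)))))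
          (vertexOfK (unitK sf sm (coDressKBmAt (toSite (ctrOff (d + 1) Lc)) Lc (KInvStep (d := d) Lc (j + 1)))) Lc (unitS sf sm (fun κ t => (cE * wE d Lc (j + 1)) • e3OfK Lc (coDressKBmAt (toSite (ctrOff (d + 1) Lc)) Lc (KInvStep (d := d) Lc j))
              (fun κ u => comp (comp (trK (psiKS (ctrOff (d + 1) Lc) Lc)) (slotPsiS (ctrOff (d + 1) Lc) Lc (ScombOf (symTablesAn1S2 d Lc cΛt) cE cVH cΛ j) κ u)) (psiKS (ctrOff (d + 1) Lc) Lc)) κ t)) μ b) yw.1 yw.2 (Sum.inl α) (Sum.inl β))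
      (fun a b t => twoFace_word_cov_of (N := Lc) (fun a' t' => hWEcov ν a' t') (fun b' t' => hWEcov μ b' t') hXs
      (ρ₁ := (fun y : Site (d + 1) => (if y α % (Lc : ℤ) = (Lc : ℤ) - 1 then (1 : ℝ) else 0))) (ρ₂ := (fun w : Site (d + 1) => (if w β % (Lc : ℤ) = (Lc : ℤ) - 1 then (1 : ℝ) else 0)))
      (fun y s => face_weight_periodic Lc α y s) (fun w s => face_weight_periodic Lc β w s) a b t (Sum.inl α) (Sum.inl β)) c
  have z11 := sum_box_transported_sector_ee_word_eq (μ := ν) (ν := μ) (α := α) (β := β) hLc hr0 hr0 sf sm (cE * wE d Lc (j + 1)) j hMc hδMc hMct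
  have z12 : ∀ c : Site (d + 1), _ := fun c => tsum_transported_sector_noFF_word_eq_zero_of_divFree (μ := μ) (ν := ν) (α := α) (β := β) hLc hr0 hr0 sf sm (cE * wE d Lc (j + 1)) j
    (locStencil_symVhS (Lc := Lc) (cVH * wVH d Lc (j + 1)) zero_le_one) one_pos (fun κ' t x z α' a => symVhS_inl_inl (Lc := Lc) (cVH * wVH d Lc (j + 1)) κ' t x z α' a) hMc hδMc hMct hMcp c
    (hD ν α) (hZ ν α)
  have z13 : ∀ c : Site (d + 1), _ := fun c => tsum_vertexOfM_right_cov_word_eq_zero hLc hr0 sf sm (j + 1) hM hδM hMcov hVE hδ hEcov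
    (fun y s => face_weight_periodic Lc α y s) (fun w s => face_weight_periodic Lc β w s) hρα hρβ μ ν (Sum.inl α) (Sum.inl β) c
  have z21 := sum_box_transported_border_sector_swap_word_eq_zero_of_divFree (μ := μ) (ν := ν) (α := α) (β := β) hLc hr0 hr0 sf sm (cE * wE d Lc (j + 1)) j hMc hδMc hMct hMcp
    (locStencil_symVhS (Lc := Lc) (cVH * wVH d Lc (j + 1)) zero_le_one) one_pos (fun κ' t x z α' a => symVhS_inl_inl (Lc := Lc) (cVH * wVH d Lc (j + 1)) κ' t x z α' a)
    (fun κ u t => symVhS_translate hLc (cVH * wVH d Lc (j + 1)) κ u t) (fun κ t z w a m hw => symVhS_inr_snd_eq_zero (Lc := Lc) (cVH * wVH d Lc (j + 1)) κ t z w a m hw) (hD μ β) (hZ μ β)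
  have z22 := (sum_box_border_border_words_eq_zero (μ := μ) (ν := ν) (α := α) (β := β) (ρ₁ := (fun y : Site (d + 1) => (if y α % (Lc : ℤ) = (Lc : ℤ) - 1 then (1 : ℝ) else 0))) (ρ₂ := (fun w : Site (d + 1) => (if w β % (Lc : ℤ) = (Lc : ℤ) - 1 then (1 : ℝ) else 0)))
    hLc hr0 sf sm (j + 1) hS hδs (transport_inl_inl (ctrOff (d + 1) Lc) (fun κ' t x z α' a => symVhS_inl_inl (Lc := Lc) (cVH * wVH d Lc (j + 1)) κ' t x z α' a))
    (transport_translate (ctrOff (d + 1) Lc) pos_Lc (fun κ u t => symVhS_translate hLc (cVH * wVH d Lc (j + 1)) κ u t))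
    (transport_inr_fst_eq_zero (ctrOff (d + 1) Lc) (fun κ t z w m b hz => symVhS_inr_fst_eq_zero (Lc := Lc) (cVH * wVH d Lc (j + 1)) κ t z w m b hz))
    (transport_inr_snd_eq_zero (ctrOff (d + 1) Lc) (fun κ t z w a m hw => symVhS_inr_snd_eq_zero (Lc := Lc) (cVH * wVH d Lc (j + 1)) κ t z w a m hw))
    hρα hρβ (fun y s => face_weight_periodic Lc α y s) (fun w s => face_weight_periodic Lc β w s) Lc).2
  have z23 : ∀ c : Site (d + 1), _ := fun c => tsum_vertexOfM_right_cov_word_eq_zero hLc hr0 sf sm (j + 1) hM hδM hMcov hVW hδ hWcov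
    (fun y s => face_weight_periodic Lc α y s) (fun w s => face_weight_periodic Lc β w s) hρα hρβ μ ν (Sum.inl α) (Sum.inl β) c
  have z31 : ∀ c : Site (d + 1), _ := fun c => tsum_left_vertexOfM_word_eq_zero hLc hr0 sf sm (j + 1) hM hδM (hLE μ c) hρα hρβ ν (Sum.inl α) (Sum.inl β)
  have z32 : ∀ c : Site (d + 1), _ := fun c => tsum_left_vertexOfM_word_eq_zero hLc hr0 sf sm (j + 1) hM hδM (hLW μ c) hρα hρβ ν (Sum.inl α) (Sum.inl β)
  have z33 : ∀ c : Site (d + 1), _ := fun c => tsum_left_vertexOfM_word_eq_zero hLc hr0 sf sm (j + 1) hM hδM (hLM μ c) hρα hρβ ν (Sum.inl α) (Sum.inl β)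
  simp only [z13, z23, z31, z32, z33, Finset.sum_const_zero, add_zero]
  simp only [symTablesAn1S2_V, swap, z12, z21, z22, Finset.sum_const_zero, add_zero]
  rw [Finset.sum_congr rfl fun c _ => swapW (toSite c)]
  exact z11

end Words

end Summit.QuantumFields.BalabanUV.Beta.GAN24.CombForcingWordsSucc

end
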